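import Summits.SmoothPoincare4.SmoothPoincare4.Theorems.NilpotentShadowsStandard.Negative.Shape

/-!
# Line `saturated-torsor-descent` — crux `CongruenceShadows.NilpotentShadowsStandard` (stmt-SmoothPoincare4-14594)

Skeleton v1 (planner-cruxplan-stmt-SmoothPoincare4-14594-saturated-torsor-des-0, 2026-08-16; line card
`Lines/saturated-torsor-descent.md`). Crux idea `Ideas/saturated-torsor-descent.md` (ideator 1, round 1), passed by all
three triagers (`TRIAGE-r1-{1,2,3}.md`) as the CHASSIS of the eight round-1 ideas.

THE CRUX. `NilpotentShadowsStandard`: for every `(3+3m, m+1)` group trisection `K` of the trivial group and every `c`,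
some automorphism `ψ` of `S = S_{3+3m}` carries `Nᵢ·γ_{c+2}S` onto `Kᵢ·γ_{c+2}S` for the three `i` at once
(`N = s4Kernels.stabilizeIter m`, `γ_{c+2}S = (⊤).lowerCentralSeries (c+1)`): the shadow of `K` in every nilpotent
quotient `S/γ_{c+2}S` is the shadow of the standard trisection of `S⁴`.

THE LINE. Induction on the level `c`. The base `c = 0` (abelian / Lagrangian shadow) is the route's own support item
`AbelianShadowStandard` (stmt-SmoothPoincare4-14599), taken BY NAME as the hypothesis of the skeleton theorem. The step
`c → c+1` is a first-order TORSOR problem (Levine's Lagrangian filtration, arXiv:math/0408310 §3, run for three handlebodies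
at once): over an on-the-nose standard level-`c` kernel `Nᵢγ_{c+2}`, the level-`(c+1)` candidates form a torsor under
`Hom(Lᵢ, L_{c+2}(H/Lᵢ))` (Levine's `J^L_{c+1}`), GENUINE single handlebody kernels land in `D_{c+1}(H/Lᵢ)`, the pair
axiom of a group trisection is the LINEAR compatibility condition on common letter blocks, the triple axiom is verbally
empty above level `0`, and the Johnson kernel `J_{c+1}` acts by translation through the joint restriction
`r = (r₀,r₁,r₂)` of `τ_{c+1}`. Consequently the step never uses the triple quotient: it is filed in its ANY-GROUP form
(`IsGroupTrisection (3+3m) (m+1) G K` for an arbitrary group `G`, plus genuineness of the three single kernels), which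
is strictly STRONGER than the crux's own step (triage r1-1/2/3: "TripleFromSingles as typed ⟺ LevelStep — type it without
the full trisection hypothesis") and is refutable on its own (balanced `(3k;k)` trisections of spun homology 3-spheres,
Meier arXiv:1708.01214 Thm 1.2 and §4.2, e.g. the `(6;2,2,2)` diagram of `𝒮(Σ(2,3,5))`, `π₁ = 2I` perfect).
The step is cut into FOUR REGIMES by Johnson degree `d = c+1` against the genus `g = 3+3m`:
* `stub_levelOne`   (`d = 1`, all `m`): Johnson's `τ₁(Torelli) = Λ³H/ωH` for closed `Σ_g`, handlebody group `↠`
  Lagrangian stabiliser in `Sp±(2g,ℤ)`, and the joint restriction `Λ³H → ⊕ᵢ Λ³(H/Lᵢ)` is onto the compatible triples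
  (monomial bookkeeping; the disprover's `levelOne_note` made unconditional);
* `stub_levelTwo`   (`d = 2`, all `m`): Morita–Yokomizo–Faes `Im τ₂ = Ker Tr^as` (arXiv:2010.16268 Thm 2.4) and the
  INTEGRAL index-1 computation `[r(D₂H) : r(Ker Tr^as)] = 1` (triage r1-1 (C1): `g = 3, 6, 9`), to be proved for all `m`;
* `stub_stableRange` (`3 ≤ d < g`): Levine's theorem `Im J_k^L ⊇ 2·D_k(H')` for `g > k`, `= D_k(H')` for `k` odd
  (arXiv:math/0408310 Thm 1 / Lemma 4.3–4.5, spare-letter brackets) — what is left is jointness and the 2-primary part at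
  even `d` (Levine's Remark 4.1 / Question 3.6 of Faes);
* `stub_unstableRange` (`d ≥ g`): the open core — isotropic-content derivations are Johnson beyond Levine's range
  (`ITJ_d(3k)`, `d ≥ 3k`; rationally = GraftingGeneration of idea `derivation-grafting-itj`, checked at rank 3 through
  `d = 8`), carrying Faes' saturation defects (Levine's question fails from `k = 3`, arXiv:2010.16268 §3–5);
plus `stub_singleKernels`: every kernel of a balanced group trisection of any group is a GENUINE handlebody kernel in
standard position (Zieschang 1964 / Grigorchuk–Kurchanov 1990 / Leininger–Reid 2002 Lemma 2.2 + Dehn–Nielsen–Baer) —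
the only place where genuineness (as opposed to verbal data) enters, and it enters for SINGLE kernels only: no
`WaldhausenPairs`, no Perelman.

COMPOSITION (kernel-checked, no sorry outside the stubs): `step_of_regimes` (every `(m,c)` lies in exactly one regime) →
`shadowStdAt_of_abelian` (any-group descent from a standard abelian shadow) → `descent` → `NilpotentShadowsStandard_of
(h0 : AbelianShadowStandard) : NilpotentShadowsStandard`.

DISPROOF USED (`Cruxes/NilpotentShadowsStandard/Disproof.lean`, cdisprove cycle 1; landed Negative lemmas imported above):
* `nilpotentShadowsStandard_false_without_trisection` (K = ⊤ junk triple): honoured — every step stub consumes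
  `IsGroupTrisection … G K` (`free_quotient` via `stub_singleKernels`, `free_pairQuotient` as the linear constraint) and the
  base consumes the full hypothesis; the junk triple `K = ⊤` has no standard single kernel.
* `nilpotentShadowsStandardAnyGroup_false_of_cyclicTrisection` (landed, `Negative/LoadBearing.lean`): honoured EXACTLY —
  the steps are any-group but CONDITIONAL on a standard level-`c` shadow; `PUnit` is load-bearing only in the base
  `AbelianShadowStandard` (for `G = ℤ/p` the abelian shadow is already non-standard, so no step applies). The theorem
  `shadowStdAt_of_abelian` below records the resulting dichotomy: for any `G`, all nilpotent shadows are standard as soon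
  as the abelian one is.
* `counterexample_shape` / `shadow_mono` (landed, `Negative/Shape.lean`): the induction on `c` IS their contrapositive
  (bad levels form an up-set), so climbing one level at a time loses nothing.
* `levelOne_note`: `stub_levelOne` is the note with its proviso (`Heeg ↠ Stab L₀ ∩ Stab L₁`, i.e. WaldhausenPairs)
  replaced by single-kernel genuineness + compatibility.
* No `-- Targets` stub kills exist yet; no refuted strengthening is used (`∃ψ ∀c` is never asserted; every stub is
  `∀c …∃ψ` one level at a time). `ledger negatives --problem SmoothPoincare4`: nothing on this crux.
-/

noncomputable section

-- the prescribed namespace `Summit.<P>.<Sub>.…` duplicates `SmoothPoincare4` (P = Sub), as in Disproof.lean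
set_option linter.dupNamespace false

namespace Summit.SmoothPoincare4.SmoothPoincare4.Cruxes.NilpotentShadowsStandard.SaturatedTorsorDescent

open Literature.Topology.FourManifolds Subgroup
open Summit.SmoothPoincare4.SmoothPoincare4.Theses.CongruenceShadows

/-! ## Local vocabulary (readability only — never used inside a registered stub signature) -/

/-- The surface group of the crux at parameter `m` (genus `3 + 3m`). [folklore] -/
abbrev S (m : ℕ) : Type := SurfaceGroup (3 + 3 * m)

/-- The standard kernel triple `N = s4Kernels.stabilizeIter m` (the genus-`(3+3m)` trisection of `S⁴`).
[cite: AbramsGayKirby2018, §2] -/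
abbrev N (m : ℕ) : TrisectionKernels (3 + 3 * m) := s4Kernels.stabilizeIter m

/-- `γ m c = γ_{c+2}(S)` in the 1-indexed convention, i.e. `(⊤).lowerCentralSeries (c+1)`; "level `c`" is the
nilpotent quotient `S / γ m c` (`c = 0`: abelianisation). [folklore] -/
abbrev γ (m c : ℕ) : Subgroup (S m) := (⊤ : Subgroup (S m)).lowerCentralSeries (c + 1)

/-- The level-`c` shadow of `K` is standard: ONE automorphism carries `Nᵢ·γ` onto `Kᵢ·γ` for the three `i`
simultaneously (the inner clause of the crux; `= Disproof.ShadowStandardAt`). [folklore] -/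
def ShadowStdAt (m : ℕ) (K : TrisectionKernels (3 + 3 * m)) (c : ℕ) : Prop :=
  ∃ ψ : S m ≃* S m, ∀ i : Fin 3, (N m i ⊔ γ m c).map ψ.toMonoidHom = K i ⊔ γ m c

/-- The three single kernels are GENUINE handlebody kernels, each individually in standard position:
`Kᵢ = αᵢ(Nᵢ)` for some automorphism `αᵢ` of `S` (one per `i`; no simultaneity is asked). [folklore] -/
def SinglesStd (m : ℕ) (K : TrisectionKernels (3 + 3 * m)) : Prop :=
  ∀ i : Fin 3, ∃ α : S m ≃* S m, (N m i).map α.toMonoidHom = K i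

/-- **The saturated torsor step** at parameter `m`, level `c → c+1`, ANY-GROUP form: for a `(3+3m, m+1)` group
trisection `K` of an ARBITRARY group `G` (Abrams–Gay–Kirby Def. 1: normal kernels, `S/Kᵢ ≅ F_{3+3m}`,
`S/⟪Kᵢ ∪ Kⱼ⟫ ≅ F_{m+1}`, triple pushout `≅ G` — only `free_pairQuotient` is used beyond the singles, and `G` is
free: take `G := K.tripleQuotient`) whose single kernels are standard and whose level-`c` shadow is standard, the
level-`(c+1)` shadow is standard. Strictly stronger than the crux's own inductive step (no triple axiom, no `PUnit`);
it is what the torsor calculus proves when it proves anything (card `saturated-torsor-descent`, Transfer C⁺, in the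
sharpened form demanded by TRIAGE-r1-1/2). [folklore] -/
def Step (m c : ℕ) : Prop :=
  ∀ (G : Type) [Group G] (K : TrisectionKernels (3 + 3 * m)),
    IsGroupTrisection (3 + 3 * m) (m + 1) G K → SinglesStd m K → ShadowStdAt m K c → ShadowStdAt m K (c + 1)

/-! ## The five registered statements, as named propositions

The registered stubs `stub_*` below repeat these texts verbatim, fully qualified and abbreviation-free (the gate records a
stub's signature from its source text and `propose --supports stmt-SmoothPoincare4-14594` must match it by name +
signature); the read-back theorems `*_stub` check that each registered text IS the named proposition (by `rfl`-elaboration). -/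

/-- **Stub S · SingleKernelsStandard** (GENUINE SINGLE KERNELS; printed theorem, unvendored; size L).
Every kernel `Kᵢ` of a `(3+3m, m+1)` group trisection of any group is the image of the standard kernel `Nᵢ` under an
automorphism of `S_{3+3m}`. Printed: an epimorphism `π₁Σ_g ↠ F_g` is induced by a handlebody (Leininger–Reid 2002
Lemma 2.2, arXiv:math/0202261 p.4, read; Jaco 1969), any two such are equivalent under `Aut π₁Σ_g` (Zieschang 1964;
Grigorchuk–Kurchanov 1990: Nielsen method on the surface relator — a purely algebraic proof), and `Nᵢ` is such a kernel
(`s4Kernels_isGroupTrisection_holds.free_quotient`, `stabilize_isGroupTrisection_holds`). Uses only `normal` +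
`free_quotient` of the hypothesis. Why it might fail: it cannot mathematically; vendoring depth (Nielsen
cancellation theory for `∏[aᵢ,bᵢ]`, or DNB + handlebody recognition) is the risk.
[cite: GrigorchukKurchanov1990, main theorem; Zieschang1964; LeiningerReid2002, Lemma 2.2] -/
def SingleKernelsStandard : Prop :=
  ∀ (m : ℕ) (G : Type) [Group G] (K : TrisectionKernels (3 + 3 * m)),
    IsGroupTrisection (3 + 3 * m) (m + 1) G K → SinglesStd m K

/-- **Stub 1 · LevelOne** (`d = c+1 = 1`, abelian → 2-step nilpotent shadow, all `m`; size L; believed TRUE).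
Torsor dictionary at level 1: data `δᵢ ∈ Hom(Lᵢ, L₂(H/Lᵢ))`, genuine single kernels give `δᵢ ∈ Λ³(H/Lᵢ) = D₁(H/Lᵢ)`
and — because the handlebody group surjects onto the stabiliser of `Lᵢ` in `Sp±(2g,ℤ)` (meridian twists give the
symmetric shears, disc slides give `GL(Lᵢ)`, a reflection the sign) and `L₁ = J₁·L_∞` (Levine) — exactly
`Oᵢ = rᵢ(Λ³H)`; the pair axiom `S/KᵢKⱼγ₃ ≅ F_k/γ₃` is coefficient agreement on the monomials of `Λ³(Cᵢ ∩ Cⱼ)`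
(empty for `k ≤ 2`, the `3·C(k,3)` monomials `b_{1j}∧b_{1j'}∧b_{1j''}` etc. for `k ≥ 3` — the disprover's
`levelOne_note` cokernel); the joint restriction `Λ³H → ⊕ᵢ Λ³(H/Lᵢ)` is onto compatible triples (each basis monomial
projects to itself in every `Λ³Cᵢ` containing it, `C₀ ∩ C₁ ∩ C₂ = ∅`); Johnson: `τ₁(Torelli(Σ_g)) = Λ³H/(ω∧H)` and
`rᵢ(ω ∧ H) = 0`. So a Torelli automorphism `ψ` with `r(τ₁ψ) = (δ₀,δ₁,δ₂)` exists and does the job. Leans on (unvendored):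
Johnson 1980 (closed surfaces), `𝓗_g ↠ Stab_{Sp}(L)` (Birman/Hirose), Labute (tree fact `Labute1970_grSurfaceGroup`),
five-term sequence `Nᵢ/[S,Nᵢ] ≅ Lᵢ` (`H₂(F_g) = 0`). Why it might fail: only through a mis-identification of the pair
axiom with the compatibility lattice at some `k ≥ 3` (checked by hand by three triagers, by machine at `k ≤ 3`).
[folklore] -/
def LevelOne : Prop := ∀ m : ℕ, Step m 0

/-- **Stub 2 · LevelTwo** (`d = 2`, all `m`; size L–XL; very plausible). Data `δᵢ ∈ D₂(H/Lᵢ)` for genuine kernels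
(Levine: `Im J₂^L ⊆ D₂(H')`); translation by `r(τ₂(J₂))` with `Im τ₂ = Ker Tr^as ⊆ D₂(H)` of 2-power index
`(g−1)(2g+1)` over `𝔽₂` (Morita, Yokomizo; Faes arXiv:2010.16268 Thm 2.4, read p.6); the INTEGRAL joint restriction
`r(Ker Tr^as)` equals `r(D₂(H))` = all pair-compatible triples in `⊕ᵢ D₂(H/Lᵢ)` at `g = 3, 6, 9` (TRIAGE-r1-1 (C1),
exact ℤ-lattices, ranks 105→18 / 312 / 1602, `Tr^as` 𝔽₂-ranks 14/65/152) — so the Morita–Yokomizo 2-torsion does not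
obstruct, and saturation is not even needed (`L₂ = J₂·L_∞` holds anyway, Morita Prop. 3.8 in Faes). To prove for all
`m`: the index-1 statement as a lattice theorem (every degree-2 class involves ≤ 3 blocks, all 3-block interactions occur
at `g = 9`) + the closed-surface form of `Im τ₂`. Why it might fail: an `m ≥ 3` compatibility class missed by the
block-polynomiality heuristic, or a closed-surface/`Aut`-vs-`Mod` discrepancy in `Im τ₂` (orientation-reversing and
inner automorphisms are harmless but unprinted). [folklore] -/
def LevelTwo : Prop := ∀ m : ℕ, Step m 1

/-- **Stub 3 · StableRange** (`3 ≤ d = c+1 < g = 3+3m`, i.e. `2 ≤ c`, `c+2 ≤ 3+3m`; vacuous at `m = 0`; size XL;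
plausible). Levine's stable range: for `g > k`, `Im J_k^L ⊇ 2·D_k(H')`, with equality `D_k(H')` for odd `k`
(arXiv:math/0408310 Thm 1, Lemma 4.3/4.5 read p.6: spare-letter bracket generation `D̃_k(H') = Σ[D₁(H), D̃_{k−1}(H')]`),
so isotropic-content classes are Johnson up to 2-torsion and the joint restriction `r(Im τ_d)` covers the compatible
triples integrally for odd `d`, up to a 2-group for even `d`; single-kernel data `Oᵢ ⊆ D_d(H/Lᵢ)` regardless of the
saturation defects (Faes: `L₃ ≠ J₃·L_∞`). What is missing: jointness for three Lagrangian complements at once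
(inclusion–exclusion over letter classes, ideas `joint-levine-inclusion-exclusion` ≈ `homology-cylinder-standardisation`)
and the 2-primary residue at even `d ≥ 4` (Levine's Remark 4.1: "reasonable to ask whether `J_k^L` is onto for all
`k < g`"). Why it might fail: an even-degree 2-torsion class of `D_d(H/Lᵢ)/rᵢ(Im τ_d)` realised by a genuine handlebody
kernel of a balanced triple but not jointly reachable — a level-`d` shadow invariant with values in a 2-group.
[folklore] -/
def StableRange : Prop := ∀ m c : ℕ, 2 ≤ c → c + 2 ≤ 3 + 3 * m → Step m c

/-- **Stub 4 · UnstableRange** (`d = c+1 ≥ g = 3+3m`; at `m = 0` every level `≥ 3`; the OPEN CORE, hardest stub).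
Beyond Levine's range neither `Im J_d^L` (single-kernel data) nor `rᵢ(Im τ_d)` is known; the step asks that the
tri-saturated level stabiliser `G^(c) = ⋂ᵢ Stab(Nᵢγ_{c+2})` reach every compatible triple of genuine single-kernel data.
Sufficient: `ITJ_d(3k)` — derivations of `𝔰_g` of degree `d` whose letter content lies inside one coordinate Lagrangian
complement `Cᵢ` are Johnson (then `Absorption_d: D_d(H) = Im τ_d + Z₀∩Z₁∩Z₂` by the tri-chromatic remark and the step
follows); rationally `ITJ` follows from GraftingGeneration (idea `derivation-grafting-itj`, verified at rank 3 for
`d ≤ 8` by three independent engines: kit j010758/j011060, triage r1-1 (C2), r1-2 Common 3), and the rational joint Levine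
restriction has full rank at `(g,d) = (3,3)` (kit j008472: Morita's `S³H` cokernel lies in the tri-stabiliser). Integral
residue: 2-primary at even `d` (mod-2 grafting defects 3, 8, 18, 1 at `d = 2,4,6,7`, rank 3) and one 5 in the one-step
grafting index at `D₃ → D₄` (closure 5-saturated, j010890). Faes' saturation defects (`Tr^A`, arXiv:2010.16268 §4–5;
arXiv:2206.10687 Thm A) enlarge BOTH the data sets `Oᵢ` and the acting group from `d = 3` on and must be carried, not
assumed away. Why it might fail: a genuinely new `Sp`-invariant obstruction in the unstable Johnson cokernel
(Morita traces `S^dH`, Enomoto–Satoh, Conant–Kassabov–Vogtmann classes are ω-contractions and vanish on isotropic content —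
consistent, not a proof), or an integral class at `(g,d) = (3,3)`/`(3,4)` separating a genus-3 trisection of a homotopy
sphere (or of `𝒮(Σ(2,3,5))`, which would kill this stub but not the crux). [folklore] -/
def UnstableRange : Prop := ∀ m c : ℕ, 3 + 3 * m < c + 2 → Step m c

/-! ## Registered stubs (`sorry` lives only here; signatures verbatim, fully qualified) -/

/-- Stub S, registered form (statement verbatim = def `SingleKernelsStandard`).
[cite: GrigorchukKurchanov1990, main theorem; LeiningerReid2002, Lemma 2.2] -/
theorem stub_singleKernels : ∀ (m : ℕ) (G : Type) [Group G] (K : Literature.Topology.FourManifolds.TrisectionKernels (3 + 3 * m)), Literature.Topology.FourManifolds.IsGroupTrisection (3 + 3 * m) (m + 1) G K → ∀ i : Fin 3, ∃ α : Literature.Topology.FourManifolds.SurfaceGroup (3 + 3 * m) ≃* Literature.Topology.FourManifolds.SurfaceGroup (3 + 3 * m), (Literature.Topology.FourManifolds.s4Kernels.stabilizeIter m i).map α.toMonoidHom = K i := by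
  sorry

/-- Stub 1, registered form (statement verbatim = def `LevelOne` = `∀ m, Step m 0`). [folklore] -/
theorem stub_levelOne : ∀ (m : ℕ) (G : Type) [Group G] (K : Literature.Topology.FourManifolds.TrisectionKernels (3 + 3 * m)), Literature.Topology.FourManifolds.IsGroupTrisection (3 + 3 * m) (m + 1) G K → (∀ i : Fin 3, ∃ α : Literature.Topology.FourManifolds.SurfaceGroup (3 + 3 * m) ≃* Literature.Topology.FourManifolds.SurfaceGroup (3 + 3 * m), (Literature.Topology.FourManifolds.s4Kernels.stabilizeIter m i).map α.toMonoidHom = K i) → (∃ ψ : Literature.Topology.FourManifolds.SurfaceGroup (3 + 3 * m) ≃* Literature.Topology.FourManifolds.SurfaceGroup (3 + 3 * m), ∀ i : Fin 3, (Literature.Topology.FourManifolds.s4Kernels.stabilizeIter m i ⊔ (⊤ : Subgroup (Literature.Topology.FourManifolds.SurfaceGroup (3 + 3 * m))).lowerCentralSeries 1).map ψ.toMonoidHom = K i ⊔ (⊤ : Subgroup (Literature.Topology.FourManifolds.SurfaceGroup (3 + 3 * m))).lowerCentralSeries 1) → ∃ ψ : Literature.Topology.FourManifolds.SurfaceGroup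 (3 + 3 * m) ≃* Literature.Topology.FourManifolds.SurfaceGroup (3 + 3 * m), ∀ i : Fin 3, (Literature.Topology.FourManifolds.s4Kernels.stabilizeIter m i ⊔ (⊤ : Subgroup (Literature.Topology.FourManifolds.SurfaceGroup (3 + 3 * m))).lowerCentralSeries 2).map ψ.toMonoidHom = K i ⊔ (⊤ : Subgroup (Literature.Topology.FourManifolds.SurfaceGroup (3 + 3 * m))).lowerCentralSeries 2 := by
  sorry

/-- Stub 2, registered form (statement verbatim = def `LevelTwo` = `∀ m, Step m 1`). [folklore] -/
theorem stub_levelTwo : ∀ (m : ℕ) (G : Type) [Group G] (K : Literature.Topology.FourManifolds.TrisectionKernels (3 + 3 * m)), Literature.Topology.FourManifolds.IsGroupTrisection (3 + 3 * m) (m + 1) G K → (∀ i : Fin 3, ∃ α : Literature.Topology.FourManifolds.SurfaceGroup (3 + 3 * m) ≃* Literature.Topology.FourManifolds.SurfaceGroup (3 + 3 * m), (Literature.Topology.FourManifolds.s4Kernels.stabilizeIter m i).map α.toMonoidHom = K i) → (∃ ψ : Literature.Topology.FourManifolds.SurfaceGroup (3 + 3 * m) ≃* Literature.Topology.FourManifolds.SurfaceGroup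 (3 + 3 * m), ∀ i : Fin 3, (Literature.Topology.FourManifolds.s4Kernels.stabilizeIter m i ⊔ (⊤ : Subgroup (Literature.Topology.FourManifolds.SurfaceGroup (3 + 3 * m))).lowerCentralSeries 2).map ψ.toMonoidHom = K i ⊔ (⊤ : Subgroup (Literature.Topology.FourManifolds.SurfaceGroup (3 + 3 * m))).lowerCentralSeries 2) → ∃ ψ : Literature.Topology.FourManifolds.SurfaceGroup (3 + 3 * m) ≃* Literature.Topology.FourManifolds.SurfaceGroup (3 + 3 * m), ∀ i : Fin 3, (Literature.Topology.FourManifolds.s4Kernels.stabilizeIter m i ⊔ (⊤ : Subgroup (Literature.Topology.FourManifolds.SurfaceGroup (3 + 3 * m))).lowerCentralSeries 3).map ψ.toMonoidHom = K i ⊔ (⊤ : Subgroup (Literature.Topology.FourManifolds.SurfaceGroup (3 + 3 * m))).lowerCentralSeries 3 := by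
  sorry

/-- Stub 3, registered form (statement verbatim = def `StableRange`: `2 ≤ c`, `c + 2 ≤ 3 + 3m`, `Step m c`).
[folklore] -/
theorem stub_stableRange : ∀ (m c : ℕ), 2 ≤ c → c + 2 ≤ 3 + 3 * m → ∀ (G : Type) [Group G] (K : Literature.Topology.FourManifolds.TrisectionKernels (3 + 3 * m)), Literature.Topology.FourManifolds.IsGroupTrisection (3 + 3 * m) (m + 1) G K → (∀ i : Fin 3, ∃ α : Literature.Topology.FourManifolds.SurfaceGroup (3 + 3 * m) ≃* Literature.Topology.FourManifolds.SurfaceGroup (3 + 3 * m), (Literature.Topology.FourManifolds.s4Kernels.stabilizeIter m i).map α.toMonoidHom = K i) → (∃ ψ : Literature.Topology.FourManifolds.SurfaceGroup (3 + 3 * m) ≃* Literature.Topology.FourManifolds.SurfaceGroup (3 + 3 * m), ∀ i : Fin 3, (Literature.Topology.FourManifolds.s4Kernels.stabilizeIter m i ⊔ (⊤ : Subgroup (Literature.Topology.FourManifolds.SurfaceGroup (3 + 3 * m))).lowerCentralSeries (c + 1)).map ψ.toMonoidHom = K i ⊔ (⊤ : Subgroup (Literature.Topology.FourManifolds.SurfaceGroup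 (3 + 3 * m))).lowerCentralSeries (c + 1)) → ∃ ψ : Literature.Topology.FourManifolds.SurfaceGroup (3 + 3 * m) ≃* Literature.Topology.FourManifolds.SurfaceGroup (3 + 3 * m), ∀ i : Fin 3, (Literature.Topology.FourManifolds.s4Kernels.stabilizeIter m i ⊔ (⊤ : Subgroup (Literature.Topology.FourManifolds.SurfaceGroup (3 + 3 * m))).lowerCentralSeries (c + 2)).map ψ.toMonoidHom = K i ⊔ (⊤ : Subgroup (Literature.Topology.FourManifolds.SurfaceGroup (3 + 3 * m))).lowerCentralSeries (c + 2) := by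
  sorry

/-- Stub 4, registered form (statement verbatim = def `UnstableRange`: `3 + 3m < c + 2`, `Step m c`). [folklore] -/
theorem stub_unstableRange : ∀ (m c : ℕ), 3 + 3 * m < c + 2 → ∀ (G : Type) [Group G] (K : Literature.Topology.FourManifolds.TrisectionKernels (3 + 3 * m)), Literature.Topology.FourManifolds.IsGroupTrisection (3 + 3 * m) (m + 1) G K → (∀ i : Fin 3, ∃ α : Literature.Topology.FourManifolds.SurfaceGroup (3 + 3 * m) ≃* Literature.Topology.FourManifolds.SurfaceGroup (3 + 3 * m), (Literature.Topology.FourManifolds.s4Kernels.stabilizeIter m i).map α.toMonoidHom = K i) → (∃ ψ : Literature.Topology.FourManifolds.SurfaceGroup (3 + 3 * m) ≃* Literature.Topology.FourManifolds.SurfaceGroup (3 + 3 * m), ∀ i : Fin 3, (Literature.Topology.FourManifolds.s4Kernels.stabilizeIter m i ⊔ (⊤ : Subgroup (Literature.Topology.FourManifolds.SurfaceGroup (3 + 3 * m))).lowerCentralSeries (c + 1)).map ψ.toMonoidHom = K i ⊔ (⊤ : Subgroup (Literature.Topology.FourManifolds.SurfaceGroup (3 + 3 * m))).lowerCentralSeries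 (c + 1)) → ∃ ψ : Literature.Topology.FourManifolds.SurfaceGroup (3 + 3 * m) ≃* Literature.Topology.FourManifolds.SurfaceGroup (3 + 3 * m), ∀ i : Fin 3, (Literature.Topology.FourManifolds.s4Kernels.stabilizeIter m i ⊔ (⊤ : Subgroup (Literature.Topology.FourManifolds.SurfaceGroup (3 + 3 * m))).lowerCentralSeries (c + 2)).map ψ.toMonoidHom = K i ⊔ (⊤ : Subgroup (Literature.Topology.FourManifolds.SurfaceGroup (3 + 3 * m))).lowerCentralSeries (c + 2) := by
  sorry

/-! ## Read-back: each registered text IS the named proposition (definitional unfolding, `0+1 = 1` etc.) -/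

/-- `stub_singleKernels` proves `SingleKernelsStandard` on the nose. [folklore] -/
theorem singleKernelsStandard_stub : SingleKernelsStandard := stub_singleKernels

/-- `stub_levelOne` proves `LevelOne = ∀ m, Step m 0` on the nose. [folklore] -/
theorem levelOne_stub : LevelOne := stub_levelOne

/-- `stub_levelTwo` proves `LevelTwo = ∀ m, Step m 1` on the nose. [folklore] -/
theorem levelTwo_stub : LevelTwo := stub_levelTwo

/-- `stub_stableRange` proves `StableRange` on the nose. [folklore] -/
theorem stableRange_stub : StableRange := stub_stableRange

/-- `stub_unstableRange` proves `UnstableRange` on the nose. [folklore] -/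
theorem unstableRange_stub : UnstableRange := stub_unstableRange

/-! ## Non-vacuity: the standard triple inhabits every hypothesis of every stub, at every `(m, c)` -/

/-- The standard triple is a `(3+3m, m+1)` group trisection of the trivial group (tree facts, discharged).
[cite: AbramsGayKirby2018, Def. 3] -/
theorem standard_isGroupTrisection (m : ℕ) :
    IsGroupTrisection (3 + 3 * m) (m + 1) (PUnit : Type) (N m) := by
  induction m with
  | zero => exact s4Kernels_isGroupTrisection_holds
  | succ n ih => exact stabilize_isGroupTrisection_holds _ _ _ _ ih

/-- The hypotheses of every step stub are simultaneously inhabited at every `(m, c)` by `K = N m`, `G = PUnit`,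
`α = ψ = id`: no stub is vacuous. [folklore] -/
theorem hypotheses_inhabited (m c : ℕ) :
    IsGroupTrisection (3 + 3 * m) (m + 1) (PUnit : Type) (N m) ∧ SinglesStd m (N m) ∧ ShadowStdAt m (N m) c :=
  ⟨standard_isGroupTrisection m, fun i => ⟨MulEquiv.refl _, by simp⟩, ⟨MulEquiv.refl _, fun i => by simp⟩⟩

/-! ## The descent (kernel-checked composition) -/

/-- Every `(m, c)` lies in exactly one of the four regimes, so the four regime statements give every step.
[folklore] -/
theorem step_of_regimes (h1 : LevelOne) (h2 : LevelTwo) (h3 : StableRange) (h4 : UnstableRange)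
    (m c : ℕ) : Step m c := by
  rcases c with _ | c
  · exact h1 m
  · rcases c with _ | c
    · exact h2 m
    · by_cases hle : c + 2 + 2 ≤ 3 + 3 * m
      · exact h3 m (c + 2) (by omega) hle
      · exact h4 m (c + 2) (by omega)

/-- **The saturated torsor descent, any-group form.** For a balanced group trisection of ANY group whose single kernels
are standard, a standard ABELIAN shadow propagates to every nilpotent level. The trivial group enters the crux only
through the base level `c = 0` — compare the landed negative lemma
`Theorems.NilpotentShadowsStandard.Negative.nilpotentShadowsStandardAnyGroup_false_of_cyclicTrisection`: for a `(3,1)`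
trisection of `ℤ/p` the base already fails, and by this theorem that is the ONLY way the any-group statement can fail
if the steps hold. [folklore] -/
theorem shadowStdAt_of_abelian (hstep : ∀ m c, Step m c) {m : ℕ} {G : Type} [Group G]
    {K : TrisectionKernels (3 + 3 * m)} (hK : IsGroupTrisection (3 + 3 * m) (m + 1) G K)
    (hs : SinglesStd m K) (h0 : ShadowStdAt m K 0) : ∀ c, ShadowStdAt m K c := by
  intro c
  induction c with
  | zero => exact h0
  | succ c ih => exact hstep m c G K hK hs ih

/-- The crux, unfolded level by level, from the route's base item and the five named statements. [folklore] -/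
theorem descent (h0 : AbelianShadowStandard) (hS : SingleKernelsStandard) (h1 : LevelOne)
    (h2 : LevelTwo) (h3 : StableRange) (h4 : UnstableRange) (m : ℕ)
    (K : TrisectionKernels (3 + 3 * m)) (hK : IsGroupTrisection (3 + 3 * m) (m + 1) (PUnit : Type) K)
    (c : ℕ) : ShadowStdAt m K c :=
  shadowStdAt_of_abelian (step_of_regimes h1 h2 h3 h4) hK (hS m PUnit K hK) (h0 m K hK) c

/-- **`NilpotentShadowsStandard_of`** — THE SKELETON: the crux BY NAME from the route's base item
`AbelianShadowStandard` (stmt-SmoothPoincare4-14599, hypothesis by name) and the registered stubs `stub_singleKernels`,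
`stub_levelOne`, `stub_levelTwo`, `stub_stableRange`, `stub_unstableRange` (through their read-backs). When the stubs land
as Theorems, replace the five `*_stub` constants by the landed names and propose this file sorry-free
(`--workitem stmt-SmoothPoincare4-14594`); it then closes the crux conditionally on item 14599 only. [folklore] -/
theorem NilpotentShadowsStandard_of (h0 : AbelianShadowStandard) : NilpotentShadowsStandard :=
  fun m K hK c => descent h0 singleKernelsStandard_stub levelOne_stub levelTwo_stub stableRange_stub
    unstableRange_stub m K hK c

end Summit.SmoothPoincare4.SmoothPoincare4.Cruxes.NilpotentShadowsStandard.SaturatedTorsorDescent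

end
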